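import Summits.AtomisticToContinuum.Crystallization.Theorems.FrustratedLawDichotomyAperiodicGapRecordJunctionGraded

/-!
(SPLIT FOR THE 400-LINE CAP by the landing lane, hand-2 g34: this file = part 1 of 2; sequels `…FrustratedLawDichotomyStrainedPatchCoverBridge` import it in a chain; same namespace, all FQNs unchanged.)
# Cover bridge: the graded COVER leaf cut into a KINEMATIC coarse cover and an ANALYTIC core refinement («CoverBridge», decomp-a2c lens-5 g81)

Lineage `…Theses.FrustratedLawDichotomy.AperiodicFrustratedLawGap` (stmt-27623); T-leaf target of record
[CORE-FAR] `CoreOffTubeFloor (63/10) (63/10) (24/5) (1/100) 0`; graded junction of record `…AperiodicGapRecordJunctionGraded` (g77/g78: the T-pair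
`(TF-G) TubeFloorG 𝓘 τ T ∧ (BC-G) FamilyCoverG 𝓘 ρ ε (1/8) τ T`).

## The undecomposed leaf.  In the whole tree NOTHING DERIVES A COVER: `FamilyCover` / `FamilyCoverG` / `CoverP` are produced only by
reformulation (`familyCover_of_familyRoom_const`, `…_constTol_iff`) or monotonicity, and every junction takes the cover as a binder.  Its evidence is
a fit of six RELAXED terminals (census COVER-60, max residual `5.3e-3`), while the exterior-driven rim adversary (lens-5 g76 §5, ASK XRT-76: rim
textures `0.02–0.03` at host shells `5.5–6.3`, admitted, not yet run) threatens exactly the cover leaf of the cell of record U125-E1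
(`FamilyCover FamP (24/5) (1/100) (1/8) (1/125)`, uniform).  This file CUTS that leaf.

## The node (lens-5 grammar: finite range = the chart CORE `R ≤ Rc`; asymptotic regime = the RIM annulus `(Rm, 63/10]` conceded at the kinematic
slack; bridge = interior DECAY across the annulus `(Rc, Rm]`, climbed rung by rung).
* **(K) coarse cover** `FamilyCoverG 𝓘₀ ρ ε η₂ τ₀ T₀` [KINEMATIC · TRUE-leaning · INSTRUMENTABLE «AFFENV-81»] — every far-class cluster is graded-charted by
  a host of a COARSE family `𝓘₀` (e.g. `latFamily` := every injective affine fcc/hcp ball, admissible or not; or `FamP` itself) at LOOSE data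
  `(τ₀, T₀)` = the kinematic envelope (what cleanliness, mono-phase and the window give with NO equilibrium input).
* **(D) the bridge** `Refine 𝓘₀ 𝓘 ρ ε η₂ τ₀ T₀ τ T` (§2) [ANALYTIC · UNDECIDED · INSTRUMENTABLE «DECAY-81» — THE RESIDUAL] — a coarse chart of a far-class
  cluster TIGHTENS, modulo an isometry and a re-fit of the host inside `𝓘`, to the tight data `(τ, T)`; with `T` tight on the core only
  (`step3Tol Rc Rm τin τmid τ₀`, §0) this is interior elliptic regularity of the chart residual under the proved force cap, and nothing else.
* **GLUE (PROVED, §2/§4)**: `(K) ∧ (D) ⟹ (BC-G)` (`familyCoverG_of_coarse_of_refine`), hence with (TF-G) ⟹ [CORE-FAR]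
  (`coreOff_of_tubeFloorG_of_coarse_of_refine`) and ⟹ the crux BY NAME (`aperiodicFrustratedLawGap_of_homFloor_625_of_coverBridge`, periodic twin too).
* **EXACT** (`familyCoverG_iff_coarse_and_refine`): when the coarse data dominate the tight data (`𝓘 ≤ 𝓘₀`, `T ≤ T₀`, `τ ≤ τ₀`) the tight cover IS
  `(K) ∧ (D)`; in particular the poly-bridge cell is an exact cut of the U-cell it refines (`familyCoverG_poly_iff`).
* **WHY EACH PIECE IS WEAKER** (PROVED): (D) ⟸ cover (`refine_of_familyCoverG`); (K) ⟸ cover by monotonicity (same family) or by the SHADOW device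
  (§3: `Shadows`, `familyCoverG_shadow`; instance of record `shadows_bentFamilyW_latFamily` ⟹ `familyCoverG_latFamily_of_cover_famP`: the affine
  parts of the bent hosts of record chart every covered cluster at the crude slack `bendSlack`).  Neither piece alone gives the cover: (K) charts at
  data no certificate survives; (D) presupposes a chart.
* **LADDER** (`Refine.trans`, `refine_ladder₂`): bridges compose — decay proved annulus by annulus assembles; «how far the finite range must reach»
  (`Rc`) is climbed one rung at a time, each rung a separately instrumentable statement.
* **NET READING** (`tubeFloorG_shadow`, `coreOff_of_net_of_shadow_of_coarse_of_refine`): a continuum family shadowed by a finite net `𝓝` at the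
  cell slack needs the graded certificate on `𝓝` only, at the fattened data — the census's cell model in graded currency (cf. 65F `BoxesCoverW`).
* **RECOVERY**: the U-cell of record and g77's two-level cell are the degenerate instances (`coreOff_record_of_uniform`, `…_polyBridge_twoLevel`).

Every theorem is sorry-free over tree definitions; tags in the docstrings: [formal bookkeeping] / [folklore] / [folklore instantiation].
The numbers (`Rc`, `Rm`, `τmid`, `τ₀`, the envelope `T₀`) are the census's (memo NODE-g81 §3: instruments DECAY-81, HARM4-81, AFFENV-81, READ-81).
-/

noncomputable section

namespace Summit.AtomisticToContinuum.Crystallization.Theorems.FrustratedLawDichotomyStrainedPatchCoverBridge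

open scoped BigOperators Classical
open Summit.AtomisticToContinuum.Crystallization.Theorems.ChargedEnergyGapNegative (eStar E3)
open Summit.AtomisticToContinuum.Crystallization.Theorems.FrustratedLawDichotomyRangeCut
open Summit.AtomisticToContinuum.Crystallization.Theorems.FrustratedLawDichotomySchurCut
open Summit.AtomisticToContinuum.Crystallization.Theorems.FrustratedLawDichotomyMotifLemmas (GoodAtScale)
open Summit.AtomisticToContinuum.Crystallization.Theorems.FrustratedLawDichotomyExemptLocOpt (LocOptFails)
open Summit.AtomisticToContinuum.Crystallization.Theorems.FrustratedLawDichotomyExemptSplit (SchurElasticPricingX)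
open Summit.AtomisticToContinuum.Crystallization.Theorems.FrustratedLawDichotomyExemptAbsorptionRecord
open Summit.AtomisticToContinuum.Crystallization.Theorems.FrustratedLawDichotomyCollarCensus
open Summit.AtomisticToContinuum.Crystallization.Theorems.FrustratedLawDichotomyCollarCensusKappa
open Summit.AtomisticToContinuum.Crystallization.Theorems.FrustratedLawDichotomyStrainedPatchHomSplit
open Summit.AtomisticToContinuum.Crystallization.Theorems.FrustratedLawDichotomyStrainedPatchCleanCollar (CleanBall TailPenalty AnnularDefectFloor
  DefectiveCollarFloor)
open Summit.AtomisticToContinuum.Crystallization.Theorems.FrustratedLawDichotomyStrainedPatchPhaseCut (MonoPhaseBall AnnularPhaseFloor PolyTextureFloor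
  monoPhaseBall_comp_iff)
open Summit.AtomisticToContinuum.Crystallization.Theorems.FrustratedLawDichotomyStrainedPatchCoreTube (NearHomIsoAt CoreOffTubeFloor nearHomIsoAt_comp_iff)
open Summit.AtomisticToContinuum.Crystallization.Theorems.FrustratedLawDichotomyStrainedPatchCoreTubeRecord (CoreCoreRelief)
open Summit.AtomisticToContinuum.Crystallization.Theorems.FrustratedLawDichotomyStrainedPatchHomIsometry (admissible_comp_iff goodAtScale_comp_iff
  dist_comp injective_comp_iff)
open Summit.AtomisticToContinuum.Crystallization.Theorems.FrustratedLawDichotomyStrainedPatchHomTubeIso (cleanBall_comp_iff)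
open Summit.AtomisticToContinuum.Crystallization.Theorems.FrustratedLawDichotomyStrainedPatchChartFamilies (ChartBy FamilyLE familyLE_refl
  ChartBy.mono_t ChartBy.mono_family)
open Summit.AtomisticToContinuum.Crystallization.Theorems.FrustratedLawDichotomyStrainedPatchChartFamiliesBent (homFamily IsBentBall bentFamily)
open Summit.AtomisticToContinuum.Crystallization.Theorems.FrustratedLawDichotomyStrainedPatchChartFamiliesPinned (polyBends bends0)
open Summit.AtomisticToContinuum.Crystallization.Theorems.FrustratedLawDichotomyStrainedPatchWindowFamilies (AdmissibleW bentFamilyW)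
open Summit.AtomisticToContinuum.Crystallization.Theorems.FrustratedLawDichotomyStrainedPatchHostCells (TubeFloor FamilyCover FamP dist_le_of_isHomBall)
open Summit.AtomisticToContinuum.Crystallization.Theorems.FrustratedLawDichotomyStrainedPatchQuantSlaving (ChartFam SlackTab)
open Summit.AtomisticToContinuum.Crystallization.Theorems.FrustratedLawDichotomyStrainedPatchGradedTube
open Summit.AtomisticToContinuum.Crystallization.Theorems.FrustratedLawDichotomyAperiodicGapRecordJunction
open Summit.AtomisticToContinuum.Crystallization.Theorems.FrustratedLawDichotomyAperiodicGapRecordJunctionGraded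
  (aperiodicFrustratedLawGap_of_homFloor_625_of_gradedTube periodicFrustratedLawGap_of_homFloor_625_of_gradedTube)

/-! ## §0. The coarse (kinematic) host family and the profile shapes -/

/-- **`latFamily`** — EVERY affinely deformed fcc/hcp `133/10`-ball with injective positions, ADMISSIBLE OR NOT (the kinematic host of a far-class
cluster is typically NOT admissible: the best affine fit of a bent everywhere-bad cluster may be `1/20`-good, or tight).  Contains every `homFamily η₃`. -/
def latFamily : ChartFam := fun _ z₀ c₀ => Function.Injective z₀ ∧ IsHomBall (133 / 10) z₀ c₀

/-- `homFamily η₃ ≤ latFamily`. [formal bookkeeping] -/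
theorem familyLE_homFamily_latFamily (η₃ : ℝ) : FamilyLE (homFamily η₃) latFamily := fun _ _ _ h => ⟨h.1.1, h.2.1⟩

/-- **`step3Tol Rc Rm τin τmid τout`** — the THREE-LEVEL radial profile: `τin` on host radius `≤ Rc` (the CHART CORE, finite range), `τmid` on `(Rc, Rm]`
(the DECAY ANNULUS), `τout` beyond `Rm` (the CONCEDED RIM, asymptotic regime). -/
def step3Tol (Rc Rm τin τmid τout : ℝ) : SlackTab := radialTol fun s => if s ≤ Rc then τin else if s ≤ Rm then τmid else τout

/-- **`quadTol a q`** — the KINEMATIC-ENVELOPE shape `a + q·s²` of the host radius `s` (the affine-fit residual of a bent field). -/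
def quadTol (a q : ℝ) : SlackTab := radialTol fun s => a + q * s ^ 2

/-- `step3Tol_apply` (docstring added by the landing lane; see the module docstring). [formal bookkeeping] -/
theorem step3Tol_apply (Rc Rm τin τmid τout : ℝ) (M₀ : ℕ) (z₀ : Fin M₀ → E3) (c₀ b : Fin M₀) :
    step3Tol Rc Rm τin τmid τout M₀ z₀ c₀ b =
      if dist (z₀ b) (z₀ c₀) ≤ Rc then τin else if dist (z₀ b) (z₀ c₀) ≤ Rm then τmid else τout := by
  rw [step3Tol, radialTol_apply]

/-- With equal middle and outer values the three-level profile IS g77's two-level `gradeTol`. [formal bookkeeping] -/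
theorem step3Tol_of_mid_eq (Rc Rm τin τout : ℝ) : step3Tol Rc Rm τin τout τout = gradeTol Rc τin τout := by
  rw [step3Tol, gradeTol_eq_radialTol]
  congr 1
  funext s
  split_ifs <;> rfl

/-- The three-level profile is monotone in its three values. [formal bookkeeping] -/
theorem tolLE_step3Tol_mono {Rc Rm τin τin' τmid τmid' τout τout' : ℝ} (h₁ : τin ≤ τin') (h₂ : τmid ≤ τmid') (h₃ : τout ≤ τout') :
    TolLE (step3Tol Rc Rm τin τmid τout) (step3Tol Rc Rm τin' τmid' τout') :=
  tolLE_radialTol fun s => by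
    split_ifs <;> assumption

/-- … and lies below the constant table at any common bound. [formal bookkeeping] -/
theorem tolLE_step3Tol_const {Rc Rm τin τmid τout τ : ℝ} (h₁ : τin ≤ τ) (h₂ : τmid ≤ τ) (h₃ : τout ≤ τ) :
    TolLE (step3Tol Rc Rm τin τmid τout) (constTol τ) := fun M₀ z₀ c₀ b => by
  rw [step3Tol_apply, constTol_apply]
  split_ifs <;> assumption

/-- … and above g77's two-level profile with the same core when `τmid, τout ≥` its outer value. [formal bookkeeping] -/
theorem tolLE_gradeTol_step3Tol {Rc Rm τin τmid τout τ : ℝ} (h₂ : τ ≤ τmid) (h₃ : τ ≤ τout) :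
    TolLE (gradeTol Rc τin τ) (step3Tol Rc Rm τin τmid τout) := fun M₀ z₀ c₀ b => by
  rw [step3Tol_apply, gradeTol_eq_radialTol, radialTol_apply]
  split_ifs <;> first | exact le_rfl | assumption

/-- The kinematic envelope is monotone in `(a, q)`. [formal bookkeeping] -/
theorem tolLE_quadTol_mono {a a' q q' : ℝ} (ha : a ≤ a') (hq : q ≤ q') : TolLE (quadTol a q) (quadTol a' q') :=
  tolLE_radialTol fun s => by
    nlinarith [sq_nonneg s]

/-! ## §1. Graded charts: scalar monotonicity and same-host weakening -/

section Chart

variable {𝓘 𝓘' : ChartFam} {τ τ' : ℝ} {T T' : SlackTab} {M : ℕ} {z : Fin M → E3} {c : Fin M} {M₀ : ℕ} {z₀ : Fin M₀ → E3} {c₀ : Fin M₀}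
  {e : Fin M → Fin M₀}

/-- A graded chart loosens with its scalar (coarse = fine clause, covering radius shrinks). [formal bookkeeping] -/
theorem chartByG_mono_scalar (h : ChartByG 𝓘 τ T z c z₀ c₀ e) (hle : τ ≤ τ') : ChartByG 𝓘 τ' T z c z₀ c₀ e :=
  ⟨(chartBy_mono_coarse h.1 hle).mono_t hle, h.2⟩

/-- ★ SAME-HOST WEAKENING: a graded chart by a host of `𝓘` at `(τ, T)` is a graded chart by the same host in any super-family at any looser data.
[formal bookkeeping] -/
theorem ChartByG.weaken (h : ChartByG 𝓘 τ T z c z₀ c₀ e) (h𝓘 : FamilyLE 𝓘 𝓘') (hT : TolLE T T') (hτ : τ ≤ τ') :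
    ChartByG 𝓘' τ' T' z c z₀ c₀ e :=
  ((chartByG_mono_scalar h hτ).mono_tol hT).mono_family h𝓘

/-- A ball site's host site lies within `63/10 + τ` of the host centre. [formal bookkeeping] -/
theorem ChartByG.host_dist_le (h : ChartByG 𝓘 τ T z c z₀ c₀ e) {a : Fin M} (ha : dist (z a) (z c) ≤ 63 / 10) :
    dist (z₀ (e a)) (z₀ c₀) ≤ 63 / 10 + τ := by
  have h1 : dist (z a - z c) (z₀ (e a) - z₀ c₀) ≤ τ := h.1.2.2.1 a ha
  rw [dist_eq_norm] at ha h1 ⊢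
  calc ‖z₀ (e a) - z₀ c₀‖ = ‖(z a - z c) - ((z a - z c) - (z₀ (e a) - z₀ c₀))‖ := by rw [sub_sub_cancel]
    _ ≤ ‖z a - z c‖ + ‖(z a - z c) - (z₀ (e a) - z₀ c₀)‖ := norm_sub_le _ _
    _ ≤ 63 / 10 + τ := add_le_add ha h1

end Chart

/-! ## §2. (D) THE BRIDGE `Refine`: a coarse chart tightens on the core; its algebra (monotone, reflexive, TRANSITIVE = the radius ladder) -/

/-- ★★ **(D) `Refine 𝓘₀ 𝓘 ρ ε η₂ τ₀ T₀ τ T` [ANALYTIC — THE BRIDGE; UNDECIDED · INSTRUMENTABLE «DECAY-81»]** — every admissible, `63/10`-clean,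
`63/10`-mono-phase, far-class (`¬NearHomIsoAt ρ ε`), `η₂`-good-centred cluster that is GRADED-charted by a host of the COARSE family `𝓘₀` at the
coarse data (scalar `τ₀`, table `T₀`) is, modulo a linear isometry, GRADED-charted by a host of `𝓘` at the TIGHT data (scalar `τ`, table `T`).
With `𝓘₀` = a kinematic family at its rigidity envelope and `T` tight on the core only, this is an INTERIOR-REGULARITY statement (decay of the
chart residual from the rim inward under the proved force cap (FC σ₁)), and nothing else. -/
def Refine (𝓘₀ 𝓘 : ChartFam) (ρ ε η₂ τ₀ : ℝ) (T₀ : SlackTab) (τ : ℝ) (T : SlackTab) : Prop :=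
  ∀ (M : ℕ) (z : Fin M → E3) (c : Fin M) (M₀ : ℕ) (z₀ : Fin M₀ → E3) (c₀ : Fin M₀) (e : Fin M → Fin M₀),
    Admissible M z c → CleanBall (63 / 10) z c → MonoPhaseBall (63 / 10) z c → ¬NearHomIsoAt ρ ε z c → GoodAtScale η₂ (3 / 2) z c →
      ChartByG 𝓘₀ τ₀ T₀ z c z₀ c₀ e →
        ∃ (R : E3 ≃ₗᵢ[ℝ] E3) (M₁ : ℕ) (z₁ : Fin M₁ → E3) (c₁ : Fin M₁) (e₁ : Fin M → Fin M₁), ChartByG 𝓘 τ T (⇑R ∘ z) c z₁ c₁ e₁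

/-- **(D⁼) `RefineAlong 𝓘₀ 𝓘 ρ ε η₂ τ₀ T₀ τ T` [ANALYTIC · STRONGER than (D)]** — the LABEL-PRESERVING form: the tight host has the coarse host's
index type, centre index and labelling `e` (the host is RE-FITTED, the correspondence kept) — the form an interior-regularity argument delivers
(and the census instrument measures: refit the host positions, keep the labels). -/
def RefineAlong (𝓘₀ 𝓘 : ChartFam) (ρ ε η₂ τ₀ : ℝ) (T₀ : SlackTab) (τ : ℝ) (T : SlackTab) : Prop :=
  ∀ (M : ℕ) (z : Fin M → E3) (c : Fin M) (M₀ : ℕ) (z₀ : Fin M₀ → E3) (c₀ : Fin M₀) (e : Fin M → Fin M₀),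
    Admissible M z c → CleanBall (63 / 10) z c → MonoPhaseBall (63 / 10) z c → ¬NearHomIsoAt ρ ε z c → GoodAtScale η₂ (3 / 2) z c →
      ChartByG 𝓘₀ τ₀ T₀ z c z₀ c₀ e →
        ∃ (R : E3 ≃ₗᵢ[ℝ] E3) (z₁ : Fin M₀ → E3), ChartByG 𝓘 τ T (⇑R ∘ z) c z₁ c₀ e

section Bridge

variable {𝓘₀ 𝓘₀' 𝓘 𝓘' 𝓘₁ 𝓘₂ : ChartFam} {ρ ε η₂ τ₀ τ₀' τ τ' τ₁ τ₂ : ℝ} {T₀ T₀' T T' T₁ T₂ : SlackTab}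

/-- (D⁼) ⟹ (D). [formal bookkeeping] -/
theorem refine_of_refineAlong (h : RefineAlong 𝓘₀ 𝓘 ρ ε η₂ τ₀ T₀ τ T) : Refine 𝓘₀ 𝓘 ρ ε η₂ τ₀ T₀ τ T :=
  fun M z c M₀ z₀ c₀ e hz hcl hm hn hg hch =>
    let ⟨R, z₁, h₁⟩ := h M z c M₀ z₀ c₀ e hz hcl hm hn hg hch
    ⟨R, M₀, z₁, c₀, e, h₁⟩

/-- ★★ **THE CUT: (K) ∧ (D) ⟹ (BC-G).**  A coarse graded cover by `𝓘₀` and the bridge give the tight graded cover by `𝓘`.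
(Isometry bookkeeping: the cluster hypotheses and the far-class / good-centre clauses are isometry-invariant — tree lemmas `admissible_comp_iff`,
`cleanBall_comp_iff`, `monoPhaseBall_comp_iff`, `nearHomIsoAt_comp_iff`, `goodAtScale_comp_iff`; the two isometries compose.) [folklore] -/
theorem familyCoverG_of_coarse_of_refine (hK : FamilyCoverG 𝓘₀ ρ ε η₂ τ₀ T₀) (hD : Refine 𝓘₀ 𝓘 ρ ε η₂ τ₀ T₀ τ T) :
    FamilyCoverG 𝓘 ρ ε η₂ τ T := by
  intro M z c hz hcl hm hn hg
  obtain ⟨R₀, M₀, z₀, c₀, e, hch⟩ := hK M z c hz hcl hm hn hg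
  obtain ⟨R₁, M₁, z₁, c₁, e₁, hch₁⟩ := hD M (⇑R₀ ∘ z) c M₀ z₀ c₀ e ((admissible_comp_iff R₀ z c).2 hz)
    ((cleanBall_comp_iff R₀ z c).2 hcl) ((monoPhaseBall_comp_iff R₀ z c).2 hm) (fun h => hn ((nearHomIsoAt_comp_iff R₀ z c).1 h))
    ((goodAtScale_comp_iff R₀ z c).2 hg) hch
  refine ⟨R₀.trans R₁, M₁, z₁, c₁, e₁, ?_⟩
  have hcomp : ⇑(R₀.trans R₁) ∘ z = ⇑R₁ ∘ (⇑R₀ ∘ z) := by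
    funext a
    simp
  rw [hcomp]
  exact hch₁

/-- (D) is WEAKER than the tight cover it feeds: the cover gives the bridge from ANY coarse data (ignore the coarse chart). [formal bookkeeping] -/
theorem refine_of_familyCoverG (h : FamilyCoverG 𝓘 ρ ε η₂ τ T) : Refine 𝓘₀ 𝓘 ρ ε η₂ τ₀ T₀ τ T :=
  fun M z c _ _ _ _ hz hcl hm hn hg _ => h M z c hz hcl hm hn hg

/-- ★ **EXACT CUT.**  When the coarse data dominate the tight data on the SAME family scale (`𝓘 ≤ 𝓘₀`, `T ≤ T₀`, `τ ≤ τ₀`), the tight graded cover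
IS the conjunction (K) ∧ (D) — nothing is lost by the cut. [folklore] -/
theorem familyCoverG_iff_coarse_and_refine (h𝓘 : FamilyLE 𝓘 𝓘₀) (hT : TolLE T T₀) (hτ : τ ≤ τ₀) :
    FamilyCoverG 𝓘 ρ ε η₂ τ T ↔ FamilyCoverG 𝓘₀ ρ ε η₂ τ₀ T₀ ∧ Refine 𝓘₀ 𝓘 ρ ε η₂ τ₀ T₀ τ T := by
  refine ⟨fun h => ⟨fun M z c hz hcl hm hn hg => ?_, refine_of_familyCoverG h⟩, fun h => familyCoverG_of_coarse_of_refine h.1 h.2⟩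
  obtain ⟨R, M₀, z₀, c₀, e, hch⟩ := h M z c hz hcl hm hn hg
  exact ⟨R, M₀, z₀, c₀, e, ChartByG.weaken hch h𝓘 hT hτ⟩

/-- (D) is MONOTONE in the tight table … [formal bookkeeping] -/
theorem Refine.mono_tol (h : Refine 𝓘₀ 𝓘 ρ ε η₂ τ₀ T₀ τ T) (hle : TolLE T T') : Refine 𝓘₀ 𝓘 ρ ε η₂ τ₀ T₀ τ T' :=
  fun M z c M₀ z₀ c₀ e hz hcl hm hn hg hch =>
    let ⟨R, M₁, z₁, c₁, e₁, h₁⟩ := h M z c M₀ z₀ c₀ e hz hcl hm hn hg hch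
    ⟨R, M₁, z₁, c₁, e₁, h₁.mono_tol hle⟩

/-- … in the tight family … [formal bookkeeping] -/
theorem Refine.mono_family (h : Refine 𝓘₀ 𝓘 ρ ε η₂ τ₀ T₀ τ T) (hle : FamilyLE 𝓘 𝓘') : Refine 𝓘₀ 𝓘' ρ ε η₂ τ₀ T₀ τ T :=
  fun M z c M₀ z₀ c₀ e hz hcl hm hn hg hch =>
    let ⟨R, M₁, z₁, c₁, e₁, h₁⟩ := h M z c M₀ z₀ c₀ e hz hcl hm hn hg hch
    ⟨R, M₁, z₁, c₁, e₁, h₁.mono_family hle⟩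

/-- … in the tight scalar … [formal bookkeeping] -/
theorem Refine.mono_scalar (h : Refine 𝓘₀ 𝓘 ρ ε η₂ τ₀ T₀ τ T) (hle : τ ≤ τ') : Refine 𝓘₀ 𝓘 ρ ε η₂ τ₀ T₀ τ' T :=
  fun M z c M₀ z₀ c₀ e hz hcl hm hn hg hch =>
    let ⟨R, M₁, z₁, c₁, e₁, h₁⟩ := h M z c M₀ z₀ c₀ e hz hcl hm hn hg hch
    ⟨R, M₁, z₁, c₁, e₁, chartByG_mono_scalar h₁ hle⟩

/-- … and ANTITONE in the coarse data: a bridge from LOOSER coarse charts is a bridge from tighter ones (table) … [formal bookkeeping] -/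
theorem Refine.anti_coarse_tol (h : Refine 𝓘₀ 𝓘 ρ ε η₂ τ₀ T₀ τ T) (hle : TolLE T₀' T₀) : Refine 𝓘₀ 𝓘 ρ ε η₂ τ₀ T₀' τ T :=
  fun M z c M₀ z₀ c₀ e hz hcl hm hn hg hch => h M z c M₀ z₀ c₀ e hz hcl hm hn hg (hch.mono_tol hle)

/-- … (family) … [formal bookkeeping] -/
theorem Refine.anti_coarse_family (h : Refine 𝓘₀ 𝓘 ρ ε η₂ τ₀ T₀ τ T) (hle : FamilyLE 𝓘₀' 𝓘₀) : Refine 𝓘₀' 𝓘 ρ ε η₂ τ₀ T₀ τ T :=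
  fun M z c M₀ z₀ c₀ e hz hcl hm hn hg hch => h M z c M₀ z₀ c₀ e hz hcl hm hn hg (hch.mono_family hle)

/-- … (scalar). [formal bookkeeping] -/
theorem Refine.anti_coarse_scalar (h : Refine 𝓘₀ 𝓘 ρ ε η₂ τ₀ T₀ τ T) (hle : τ₀' ≤ τ₀) : Refine 𝓘₀ 𝓘 ρ ε η₂ τ₀' T₀ τ T :=
  fun M z c M₀ z₀ c₀ e hz hcl hm hn hg hch => h M z c M₀ z₀ c₀ e hz hcl hm hn hg (chartByG_mono_scalar hch hle)

/-- (D) is REFLEXIVE: every chart refines itself (`R = 1`). [formal bookkeeping] -/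
theorem refine_self (𝓘 : ChartFam) (ρ ε η₂ τ : ℝ) (T : SlackTab) : Refine 𝓘 𝓘 ρ ε η₂ τ T τ T :=
  fun M z c M₀ z₀ c₀ e _ _ _ _ _ hch =>
    ⟨LinearIsometryEquiv.refl ℝ E3, M₀, z₀, c₀, e, by rw [LinearIsometryEquiv.coe_refl, Function.id_comp]; exact hch⟩

/-- ★★ **THE RADIUS LADDER: (D) is TRANSITIVE.**  A bridge from the coarse data to intermediate data and a bridge from the intermediate data to the
tight data compose — interior decay proved ANNULUS BY ANNULUS (rim → decay annulus → core) assembles into the bridge of record; «how far the finite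
range must reach» is climbed one rung at a time. [folklore] -/
theorem Refine.trans (h₁ : Refine 𝓘₀ 𝓘₁ ρ ε η₂ τ₀ T₀ τ₁ T₁) (h₂ : Refine 𝓘₁ 𝓘₂ ρ ε η₂ τ₁ T₁ τ₂ T₂) : Refine 𝓘₀ 𝓘₂ ρ ε η₂ τ₀ T₀ τ₂ T₂ := by
  intro M z c M₀ z₀ c₀ e hz hcl hm hn hg hch
  obtain ⟨R₁, M₁, z₁, c₁, e₁, hch₁⟩ := h₁ M z c M₀ z₀ c₀ e hz hcl hm hn hg hch
  obtain ⟨R₂, M₂, z₂, c₂, e₂, hch₂⟩ := h₂ M (⇑R₁ ∘ z) c M₁ z₁ c₁ e₁ ((admissible_comp_iff R₁ z c).2 hz)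
    ((cleanBall_comp_iff R₁ z c).2 hcl) ((monoPhaseBall_comp_iff R₁ z c).2 hm) (fun h => hn ((nearHomIsoAt_comp_iff R₁ z c).1 h))
    ((goodAtScale_comp_iff R₁ z c).2 hg) hch₁
  refine ⟨R₁.trans R₂, M₂, z₂, c₂, e₂, ?_⟩
  have hcomp : ⇑(R₁.trans R₂) ∘ z = ⇑R₂ ∘ (⇑R₁ ∘ z) := by
    funext a
    simp
  rw [hcomp]
  exact hch₂

/-- The same for the label-preserving form. [folklore] -/
theorem RefineAlong.trans (h₁ : RefineAlong 𝓘₀ 𝓘₁ ρ ε η₂ τ₀ T₀ τ₁ T₁) (h₂ : RefineAlong 𝓘₁ 𝓘₂ ρ ε η₂ τ₁ T₁ τ₂ T₂) :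
    RefineAlong 𝓘₀ 𝓘₂ ρ ε η₂ τ₀ T₀ τ₂ T₂ := by
  intro M z c M₀ z₀ c₀ e hz hcl hm hn hg hch
  obtain ⟨R₁, z₁, hch₁⟩ := h₁ M z c M₀ z₀ c₀ e hz hcl hm hn hg hch
  obtain ⟨R₂, z₂, hch₂⟩ := h₂ M (⇑R₁ ∘ z) c M₀ z₁ c₀ e ((admissible_comp_iff R₁ z c).2 hz)
    ((cleanBall_comp_iff R₁ z c).2 hcl) ((monoPhaseBall_comp_iff R₁ z c).2 hm) (fun h => hn ((nearHomIsoAt_comp_iff R₁ z c).1 h))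
    ((goodAtScale_comp_iff R₁ z c).2 hg) hch₁
  refine ⟨R₁.trans R₂, z₂, ?_⟩
  have hcomp : ⇑(R₁.trans R₂) ∘ z = ⇑R₂ ∘ (⇑R₁ ∘ z) := by
    funext a
    simp
  rw [hcomp]
  exact hch₂

/-- ★ TWO-RUNG LADDER at fixed families: rim → decay annulus, then decay annulus → core. [formal bookkeeping] -/
theorem refine_ladder₂ (h₁ : Refine 𝓘₀ 𝓘 ρ ε η₂ τ₀ T₀ τ₁ T₁) (h₂ : Refine 𝓘 𝓘 ρ ε η₂ τ₁ T₁ τ T) : Refine 𝓘₀ 𝓘 ρ ε η₂ τ₀ T₀ τ T :=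
  h₁.trans h₂

end Bridge

end Summit.AtomisticToContinuum.Crystallization.Theorems.FrustratedLawDichotomyStrainedPatchCoverBridge

end
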